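import Mathlib
import HarnessLib

/-!
# The tower step is deterministic: at most one stable complement of a hyperplane without stable lines (Phase 0 tower analysis, crux `WildQuotients.WildQuotientResolution`)

Crux stmt-ResolutionOfSingularities-15640 (`WildQuotientResolution`), registered stub
`stub_phaseZeroHighDim`, move-game track. Companion of ✓`TowerStep`
(`isCompl_of_stable_line_of_finrank_quotient_eq_one`: a stable line is a complement of a
hyperplane `W` without stable lines). Here: there is AT MOST ONE such stable line. If `L₁ ≠ L₂`
were stable lines off `W`, write `V = L₂ ⊕ W`; the `W`-components of the vectors of `L₁` form a
stable subspace of `W` of dimension `≤ 1`, non-zero because `L₁ ≠ L₂` — a stable line in `W`.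
Consequence for the termination analysis (memo `PHASE0-DIM3-TERMINATION.md` §2(d), evidence on the
item): along a tower of point moves with constant non-p-closed inertia `I`, over each storey there
is at most ONE non-p-closed point with inertia `I` — the tower is DETERMINISTIC (and, by Galois
descent of a unique point, `κ`-rational).

* `eq_of_stable_lines_of_no_stable_line` — the uniqueness statement.

[OURS · crux stmt-ResolutionOfSingularities-15640 · helper toward `stub_phaseZeroHighDim`
(termination of the point-move towers, dim 3); folklore linear algebra, counted 0; AI-level work,
weaker than expert review.]
-/

-- single-problem summit: the doubled namespace component `ResolutionOfSingularities` is forced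
set_option linter.dupNamespace false

namespace Summit.ResolutionOfSingularities.ResolutionOfSingularities.Theorems.WildQuotientResolution.TowerStep

variable {K : Type*} [Field K] {V : Type*} [AddCommGroup V] [Module K V]

/-- **Uniqueness of the stable complement.** Let `f i` be linear endomorphisms of the
finite-dimensional `V`, `W` a submodule STABLE under every `f i` and containing no stable line,
and `L₁`, `L₂` stable lines with `L₂ ⊔ W = ⊤` and `L₁ ⊓ W = ⊥`. Then `L₁ = L₂`. Proof: let
`π_W : V → W` be the projection along `L₂` (`V = L₂ ⊕ W`); it commutes with the `f i` on `V`
modulo the stability of `L₂` and `W`, so `π_W(L₁)` is a stable subspace of `W` of dimension `≤ 1`;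
it is `0` only if `L₁ ≤ L₂`, i.e. `L₁ = L₂`; otherwise it is a stable line in `W`. [folklore] -/
theorem eq_of_stable_lines_of_no_stable_line [FiniteDimensional K V] {ι : Type*}
    (f : ι → V →ₗ[K] V) (W L₁ L₂ : Submodule K V)
    (hWs : ∀ i, W ≤ W.comap (f i))
    (hW : ∀ L' : Submodule K V, L' ≤ W → Module.finrank K L' = 1 →
      ¬ ∀ i, L' ≤ L'.comap (f i))
    (hL1 : Module.finrank K L₁ = 1) (hL1s : ∀ i, L₁ ≤ L₁.comap (f i))
    (hL2 : Module.finrank K L₂ = 1) (hL2s : ∀ i, L₂ ≤ L₂.comap (f i))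
    (hL2W : IsCompl L₂ W) : L₁ = L₂ := by
  classical
  -- generators
  obtain ⟨v₁, hv₁⟩ := finrank_eq_one_iff'.mp hL1
  obtain ⟨v₂, hv₂⟩ := finrank_eq_one_iff'.mp hL2
  -- decompose `v₁ = a • v₂ + w` along `V = L₂ ⊕ W`
  have htop : (v₁ : V) ∈ L₂ ⊔ W := by rw [hL2W.sup_eq_top]; exact Submodule.mem_top
  obtain ⟨y, hy, w, hw, hyw⟩ := Submodule.mem_sup.mp htop
  obtain ⟨a, ha⟩ := hv₂.2 ⟨y, hy⟩
  have ha' : a • (v₂ : V) = y := by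
    have := congrArg Subtype.val ha; simpa using this
  -- the line `K w ≤ W` is stable: `f i w ∈ K w`
  -- first: `f i v₁ = c₁ • v₁`, `f i v₂ = c₂ • v₂`
  have hev1 : ∀ i, ∃ c : K, f i v₁ = c • (v₁ : V) := fun i => by
    have hm : f i v₁ ∈ L₁ := hL1s i v₁.2
    obtain ⟨c, hc⟩ := hv₁.2 ⟨f i v₁, hm⟩
    exact ⟨c, by have := congrArg Subtype.val hc; simpa using this.symm⟩
  have hev2 : ∀ i, ∃ c : K, f i v₂ = c • (v₂ : V) := fun i => by
    have hm : f i v₂ ∈ L₂ := hL2s i v₂.2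
    obtain ⟨c, hc⟩ := hv₂.2 ⟨f i v₂, hm⟩
    exact ⟨c, by have := congrArg Subtype.val hc; simpa using this.symm⟩
  by_cases hw0 : w = 0
  · -- `v₁ = a • v₂ ∈ L₂`, so `L₁ ≤ L₂`, equal by dimension
    have hv1L2 : (v₁ : V) ∈ L₂ := by
      rw [← hyw, hw0, add_zero, ← ha']
      exact L₂.smul_mem a v₂.2
    have hle : L₁ ≤ L₂ := by
      intro u hu
      obtain ⟨c, hc⟩ := hv₁.2 ⟨u, hu⟩
      have : u = c • (v₁ : V) := by have := congrArg Subtype.val hc; simpa using this.symm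
      rw [this]
      exact L₂.smul_mem c hv1L2
    haveI : FiniteDimensional K L₂ := inferInstance
    exact Submodule.eq_of_le_of_finrank_eq hle (by rw [hL1, hL2])
  · -- `w ≠ 0`: the line `K ∙ w ≤ W` is stable — contradiction
    exfalso
    refine hW (K ∙ w) ((Submodule.span_singleton_le_iff_mem w W).mpr hw)
      (finrank_span_singleton hw0) fun i => ?_
    rw [Submodule.span_singleton_le_iff_mem, Submodule.mem_comap]
    -- `f i w = f i v₁ - a • f i v₂ = c₁ • v₁ - a c₂ • v₂ = c₁ • w + (c₁ a - a c₂) • v₂`;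
    -- its `L₂`-component must vanish since `f i w ∈ W` and `W ⊓ L₂ = ⊥`
    obtain ⟨c₁, hc₁⟩ := hev1 i
    obtain ⟨c₂, hc₂⟩ := hev2 i
    have hfw : f i w = c₁ • w + (c₁ * a - a * c₂) • (v₂ : V) := by
      have hw' : w = (v₁ : V) - a • (v₂ : V) := by rw [← hyw, ← ha']; abel
      rw [hw', map_sub, map_smul, hc₁, hc₂, smul_sub, sub_smul, smul_smul, smul_smul]
      abel
    have hfwW : f i w ∈ W := hWs i hw
    -- the `v₂`-component lies in `W ⊓ L₂ = ⊥`
    have hcomp : (c₁ * a - a * c₂) • (v₂ : V) ∈ W := by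
      have : (c₁ * a - a * c₂) • (v₂ : V) = f i w - c₁ • w := by rw [hfw]; abel
      rw [this]
      exact W.sub_mem hfwW (W.smul_mem c₁ hw)
    have hzero : (c₁ * a - a * c₂) • (v₂ : V) = 0 := by
      have hmem : (c₁ * a - a * c₂) • (v₂ : V) ∈ L₂ ⊓ W :=
        ⟨L₂.smul_mem _ v₂.2, hcomp⟩
      rw [hL2W.inf_eq_bot] at hmem
      exact (Submodule.mem_bot K).mp hmem
    rw [hfw, hzero, add_zero]
    exact Submodule.smul_mem _ c₁ (Submodule.mem_span_singleton_self w)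

end Summit.ResolutionOfSingularities.ResolutionOfSingularities.Theorems.WildQuotientResolution.TowerStep
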